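import Literature.NumberTheory.Automorphic.LanglandsTunnellCases
import HarnessLib

/-!
# Langlands–Tunnell, Artin side: the tagged twin from the case assembly (proved)
(companion to `Literature.NumberTheory.Automorphic.LanglandsTunnellCases`)

`Automorphic/LanglandsTunnellCases` proves the untagged Artin-side fact
`Literature.NumberTheory.Automorphic.langlands_tunnell_hasEntireContinuation` (`Automorphic/ArtinLFunctions`) from the
three cases of the strong Artin conjecture (`strongArtin_of_isDihedralType`,
`strongArtin_of_isTetrahedralType`, `strongArtin_of_isOctahedralType` of
`Automorphic/StrongArtinGL2`) and the bridge
`hasEntireContinuation_artinLFunction_of_isPiOfArtinRep` (Tunnell 1981, p. 173: "when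
`π = π(ρ)` the L-series of `π` and `ρ` agree, and since cuspidal representations have entire
L-series, Artin's conjecture follows").  This file records the same consequence for the
per-`ρ` **tagged twin** `Literature.Lang.hasEntireContinuation_artinLFunction_of_isSolvable ρ` of
`Automorphic/LanglandsTunnell` (lang.S30's "hence" clause), which is the same statement
(`FramedRep.IsIrreducible ρ` is by definition `ρ.toGaloisRep.IsIrreducible`;
`langlands_tunnell_hasEntireContinuation_iff_forall` in `Automorphic/ArtinLFunctionsProofs`),
so that a discharge of the four inputs serves both facts.  All statements here are proved.

## References

* J. Tunnell, *Artin's conjecture for representations of octahedral type*, Bull. AMS (N.S.) 5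
  (1981), 173–175: p. 173 and Theorem. [Tunnell1981]
* S. Gelbart, *Three lectures on the modularity of `ρ̄_{E,3}` and the Langlands reciprocity
  conjecture*, in: Modular Forms and Fermat's Last Theorem (1997), Thm. 1.3 and Remark (1),
  Thm. 2.1. [Gelbart1997]
-/

noncomputable section

open scoped MatrixGroups NumberField

namespace Literature.NumberTheory.Automorphic

/-- **lang.S30's "hence" clause from the printed inputs.**  The per-`ρ` tagged twin
`hasEntireContinuation_artinLFunction_of_isSolvable ρ` of `Automorphic/LanglandsTunnell` (an odd
irreducible `ρ : Γ_ℚ → GL_2(ℂ)` with solvable image has entire Artin L-function) follows, for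
every `ρ`, from the dihedral, tetrahedral and octahedral cases of the strong Artin conjecture
and the bridge (`hasEntireContinuation_artinLFunction_of_isSolvable_of_cases`; the oddness
hypothesis is unused). [cite: Tunnell1981, p. 173 and Theorem]
[cite: Gelbart1997, Thm. 1.3, Remark (1)] -/
theorem hasEntireContinuation_artinLFunction_of_isSolvable_of_three_cases
    (hd : strongArtin_of_isDihedralType) (ht : strongArtin_of_isTetrahedralType)
    (ho : strongArtin_of_isOctahedralType)
    (hB : hasEntireContinuation_artinLFunction_of_isPiOfArtinRep) (ρ : GaloisRepresentations.FramedArtinRep ℚ 2) :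
    hasEntireContinuation_artinLFunction_of_isSolvable ρ :=
  fun hirr _ hsolv =>
    hasEntireContinuation_artinLFunction_of_isSolvable_of_cases hd ht ho hB ρ hirr hsolv

/-- The per-`ρ` tagged twin from Gelbart's Thm. 2.1 (`strongArtin_of_isSolvable`) and the
bridge (`hasEntireContinuation_artinLFunction_of_strongArtin`; oddness unused).
[cite: Tunnell1981, p. 173] [cite: Gelbart1997, Thm. 2.1] -/
theorem hasEntireContinuation_artinLFunction_of_isSolvable_of_strongArtin_of_isPiOfArtinRep
    (hSA : strongArtin_of_isSolvable)
    (hB : hasEntireContinuation_artinLFunction_of_isPiOfArtinRep) (ρ : GaloisRepresentations.FramedArtinRep ℚ 2) :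
    hasEntireContinuation_artinLFunction_of_isSolvable ρ :=
  fun hirr _ hsolv => hasEntireContinuation_artinLFunction_of_strongArtin hSA hB ρ hirr hsolv

/-- All `ρ` at once: the three cases and the bridge give every tagged twin; this is literally
`langlands_tunnell_hasEntireContinuation_of_cases`, the untagged fact and the family of tagged
twins being the same statement. [folklore] -/
theorem forall_hasEntireContinuation_artinLFunction_of_isSolvable_of_three_cases
    (hd : strongArtin_of_isDihedralType) (ht : strongArtin_of_isTetrahedralType)
    (ho : strongArtin_of_isOctahedralType)
    (hB : hasEntireContinuation_artinLFunction_of_isPiOfArtinRep) :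
    ∀ ρ : GaloisRepresentations.FramedArtinRep ℚ 2, hasEntireContinuation_artinLFunction_of_isSolvable ρ :=
  langlands_tunnell_hasEntireContinuation_of_cases hd ht ho hB

end Literature.NumberTheory.Automorphic

end
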